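import Summits.QuantumFields.YangMills.Theorems.UnitScaleGibbsBlockPlaquetteOneStepFullLinearisation
import HarnessLib

/-!
# `UnitScaleGibbsBlockPlaquetteLinWeightDefs` — THE NESTED OFFSET-MEAN WEIGHTS `linWeight j a p` OF THE j-FOLD LINEARISATION OF A BLOCK PLAQUETTE
# (ONE recursive `def` + its algebra; brick (W) of the S_lin stub of the crux idea «gross-sd-transfer», LINE 28 candidate on `UnitScaleTilt.HistoryTailL`)

Cell `ym3-torus` (YM ladder rung R3 = continuum SU(2) Yang–Mills on T³ — a RUNG, NOT the Clay problem: not d = 4, not infinite volume, not a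
mass gap), crux of record `UnitScaleTilt.HistoryTailL` (stmt-QuantumFields-19936), width seat `ym-ust-19936-w2` (gen 14).  `GrossTransferAnnex4.md`
(ideator ym-r3-idea-2 g15, 2026-08-29) §6: *«stub_lin : dist₁(Ū^{j}(∂a))² ≤ 2N²·Y² + R_lin on G … the genuinely laborious stub; w2∕px10 hold the pen on the
engines»*; §0 CONSTRUCTION C3 («tree-gauge dressing»): the observable is read on the axial-gauge REPRESENTATIVE `V`, all of whose bond variables in
the box are near `1` on the small-field event — so the `j`-fold linearisation of the block plaquette needs NO transports: what survives is ONE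
DETERMINISTIC SCALAR WEIGHT per (coarse plaquette, fine plaquette) pair.  This file defines that weight and proves its algebra; the companion
`UnitScaleGibbsBlockPlaquetteTransportFreeLinearisation` (def-free) proves the `j`-fold bound
`‖(V̄^{j}(∂a) − 1) − Σ_p linWeight j a p • (V(∂p) − 1)‖ ≤ ρ_j` by induction over px10 g7's one-step engine ✓`UnitScaleGibbsBlockPlaquetteOneStepFullLinearisation`.

THE DEFINITION (the ONLY non-def-free object S_lin needs; a `def` rather than an `∃` so that further properties — e.g. the load-bearing decay
«(W-P4) `linWeight j a p ≤ c·L^{−j}`» — can be PROVED LATER by anyone instead of being frozen inside one existential):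
* `linWeight 0 a p = [a = p]` (the fine plaquette itself);
* `linWeight (j+1) a′ p = |J|⁻¹ · Σ_{J=(r,σ,τ,ρ,ω)} Σ_{t<L} Σ_{s<L} linWeight j (p^{J}_{s,t}(a′)) p`, where `p^{J}_{s,t}(a′) = ⟨shiftN (shiftN x_J ν t) μ s, μ, ν⟩`,
  `x_J = walkEnd (emb a′.src) (stairWord σ (off r))`, are EXACTLY the `|J|·L²` tiles of the translated `L×L` squares of ✓`…OneStepFullLinearisation`
  (px10 g7's (K) letters verbatim): the coupled (0.4) offset-mean over `J ∈ (Fin d → Fin L) × Perm⁴` ([Balaban1987RG1] (0.3)–(0.4)), then the Stokes tiling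
  ([Balaban1985Averaging] (19), (47)–(48)).
Print: [Balaban1985Averaging] T. Bałaban, CMP 98 (1985) 17–51, (48) p. 26 *«Σ_{c⊂∂p′} Σ_{x∈B(c₋)} L^{−d} A(Γ_{c,x}) = Σ_{x∈B(y₀)} L^{−d} A(∂(p′)_x) =
Σ_{x∈B(y₀)} L^{−d} Σ_{p⊂(p′)_x} A(∂p)»* — the one-step weights; iterated `j` times they are `linWeight j`.

WHAT THIS FILE PROVES (kernel; ONE `def`, 0 `sorry`; no `instance`, no `notation`): `linWeight_zero_self`, `linWeight_zero_of_ne`, `linWeight_succ`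
(the defining equations), ★`linWeight_nonneg`, ★`sum_linWeight` (`Σ_p linWeight j a p = (L·L)^j`: total mass = the number of fine plaquettes tiling the
coarse one), `sum_linWeight_zero_smul` (`Σ_p linWeight 0 a p • X p = X a`), ★`sum_linWeight_succ_smul` (the linear proxy unfolds one level:
`Σ_p linWeight (j+1) a′ p • X p = |J|⁻¹ • Σ_J Σ_{t,s} Σ_p linWeight j (p^J_{s,t}) p • X p` — the shape the (S)-engine's proxy `A` takes in the induction).

HONEST FRAMING.  A definition of lattice bookkeeping weights on the tree's own objects (`--supports stmt-QuantumFields-19936`; review lane); proves no stub,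
crux, rung or summit statement; (W-P4), stub_lin, «ShallowFluxSecondMomentL», (Q), K1, `MeanDeviationL`, `HistoryTailL` are NOT proved; the
Yang–Mills mass gap is NOT proved.

References: [Balaban1985Averaging] T. Bałaban, CMP 98 (1985) 17–51, (19) p. 21, (47)–(48) p. 25–26; [Balaban1987RG1] T. Bałaban, CMP 109 (1987) 249–301,
(0.3)–(0.4) pp. 252–253.
-/

noncomputable section

open scoped BigOperators

namespace Summit.QuantumFields.YangMills.Theorems.UnitScaleGibbsBlockPlaquetteLinWeight

open Literature.MathematicalPhysics.QuantumFieldTheory.Balaban1983to89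
open Literature.MathematicalPhysics.QuantumFieldTheory.Balaban1983to89.B10Eq47AxialChi (shiftN)
open Literature.MathematicalPhysics.QuantumFieldTheory.Balaban1983to89.BlockAveraging (off)
open T4Continuum (walkEnd stairWord)

variable {P : Params}

/-! ## The definition -/

open scoped Classical in
/-- **THE NESTED OFFSET-MEAN WEIGHT** `linWeight j a p` of the fine plaquette `p : Plaq P 0` in the `j`-fold transport-free linearisation of the
coarse plaquette `a : Plaq P j`: `[a = p]` at `j = 0`, and one level up the `|J|⁻¹`-weighted sum over the coupled (0.4) index `J` and the `L²`
tiles of the translated square of the weights of the tiles. [cite: Balaban1985Averaging, (47)-(48) pp.25-26; Balaban1987RG1, (0.3)-(0.4) pp.252-253] -/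
def linWeight : (j : ℕ) → Plaq P j → Plaq P 0 → ℝ
  | 0 => fun a p => if a = p then 1 else 0
  | j + 1 => fun a p =>
      ((Fintype.card ((Fin P.d → Fin P.L) × Equiv.Perm (Fin P.d) × Equiv.Perm (Fin P.d) × Equiv.Perm (Fin P.d) ×
          Equiv.Perm (Fin P.d)) : ℝ))⁻¹ *
        ∑ J : (Fin P.d → Fin P.L) × Equiv.Perm (Fin P.d) × Equiv.Perm (Fin P.d) × Equiv.Perm (Fin P.d) × Equiv.Perm (Fin P.d),
          ∑ t ∈ Finset.range P.L, ∑ s ∈ Finset.range P.L,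
            linWeight j ⟨shiftN (shiftN (walkEnd (emb a.src) (stairWord J.2.1 (off J.1))) a.ν t) a.μ s, a.μ, a.ν, a.hμν⟩ p

/-! ## The defining equations -/

/-- `linWeight 0 a a = 1`. [cite: Balaban1985Averaging, (47)-(48) pp.25-26] -/
@[simp] theorem linWeight_zero_self (a : Plaq P 0) : linWeight 0 a a = 1 := by
  simp [linWeight]

/-- `linWeight 0 a p = 0` for `p ≠ a`. [cite: Balaban1985Averaging, (47)-(48) pp.25-26] -/
theorem linWeight_zero_of_ne {a p : Plaq P 0} (h : a ≠ p) : linWeight 0 a p = 0 := by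
  simp [linWeight, h]

/-- The recursion: `linWeight (j+1) a′ p = |J|⁻¹ · Σ_J Σ_{t<L} Σ_{s<L} linWeight j (p^J_{s,t}(a′)) p`. [cite: Balaban1985Averaging, (47)-(48) pp.25-26] -/
theorem linWeight_succ (j : ℕ) (a : Plaq P (j + 1)) (p : Plaq P 0) :
    linWeight (j + 1) a p =
      ((Fintype.card ((Fin P.d → Fin P.L) × Equiv.Perm (Fin P.d) × Equiv.Perm (Fin P.d) × Equiv.Perm (Fin P.d) ×
          Equiv.Perm (Fin P.d)) : ℝ))⁻¹ *
        ∑ J : (Fin P.d → Fin P.L) × Equiv.Perm (Fin P.d) × Equiv.Perm (Fin P.d) × Equiv.Perm (Fin P.d) × Equiv.Perm (Fin P.d),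
          ∑ t ∈ Finset.range P.L, ∑ s ∈ Finset.range P.L,
            linWeight j ⟨shiftN (shiftN (walkEnd (emb a.src) (stairWord J.2.1 (off J.1))) a.ν t) a.μ s, a.μ, a.ν, a.hμν⟩ p := by
  rfl

/-! ## Nonnegativity and total mass -/

/-- **`0 ≤ linWeight j a p`.** [cite: Balaban1985Averaging, (47)-(48) pp.25-26] -/
theorem linWeight_nonneg : ∀ (j : ℕ) (a : Plaq P j) (p : Plaq P 0), 0 ≤ linWeight j a p
  | 0, a, p => by
    by_cases h : a = p
    · subst h; simp
    · rw [linWeight_zero_of_ne h]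
  | j + 1, a, p => by
    rw [linWeight_succ]
    refine mul_nonneg (inv_nonneg.mpr (Nat.cast_nonneg _)) ?_
    exact Finset.sum_nonneg fun J _ => Finset.sum_nonneg fun t _ => Finset.sum_nonneg fun s _ => linWeight_nonneg j _ p

/-- The coupled index type is nonempty (so `|J|⁻¹ · |J| = 1`). [cite: Balaban1987RG1, (0.3)-(0.4) pp.252-253 (bookkeeping)] -/
theorem card_index_ne_zero :
    (Fintype.card ((Fin P.d → Fin P.L) × Equiv.Perm (Fin P.d) × Equiv.Perm (Fin P.d) × Equiv.Perm (Fin P.d) × Equiv.Perm (Fin P.d)) : ℝ) ≠ 0 := by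
  haveI : Nonempty (Fin P.d → Fin P.L) := ⟨fun _ => ⟨0, P.L_pos⟩⟩
  exact Nat.cast_ne_zero.mpr Fintype.card_ne_zero

/-- **TOTAL MASS `Σ_p linWeight j a p = (L·L)^j`**: the number of fine plaquettes tiling the coarse one (each level multiplies by the `L²` tiles,
the offset-mean being an average). [cite: Balaban1985Averaging, (47)-(48) pp.25-26] -/
theorem sum_linWeight : ∀ (j : ℕ) (a : Plaq P j), ∑ p : Plaq P 0, linWeight j a p = ((P.L : ℝ) * P.L) ^ j
  | 0, a => by
    rw [pow_zero, Finset.sum_eq_single a (fun p _ hp => linWeight_zero_of_ne (Ne.symm hp)) (fun h => absurd (Finset.mem_univ a) h),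
      linWeight_zero_self]
  | j + 1, a => by
    simp only [linWeight_succ]
    rw [← Finset.mul_sum, Finset.sum_comm]
    have inner : ∀ J : (Fin P.d → Fin P.L) × Equiv.Perm (Fin P.d) × Equiv.Perm (Fin P.d) × Equiv.Perm (Fin P.d) × Equiv.Perm (Fin P.d),
        ∑ p : Plaq P 0, ∑ t ∈ Finset.range P.L, ∑ s ∈ Finset.range P.L,
          linWeight j ⟨shiftN (shiftN (walkEnd (emb a.src) (stairWord J.2.1 (off J.1))) a.ν t) a.μ s, a.μ, a.ν, a.hμν⟩ p =
          ((P.L : ℝ) * P.L) * ((P.L : ℝ) * P.L) ^ j := by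
      intro J
      rw [Finset.sum_comm]
      simp_rw [Finset.sum_comm (s := (Finset.univ : Finset (Plaq P 0))) (t := Finset.range P.L), sum_linWeight j]
      simp [Finset.sum_const, Finset.card_range]
      ring
    simp_rw [inner]
    rw [Finset.sum_const, Finset.card_univ, nsmul_eq_mul, ← mul_assoc, inv_mul_cancel₀ card_index_ne_zero, one_mul, pow_succ]
    ring

/-! ## The linear proxy: unfolding one level -/

section Proxy

variable {𝕄 : Type*} [AddCommGroup 𝕄] [Module ℂ 𝕄]

/-- `Σ_p linWeight 0 a p • X p = X a` (the level-`0` proxy is the fine plaquette variable itself). [cite: Balaban1985Averaging, (47)-(48) pp.25-26] -/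
theorem sum_linWeight_zero_smul (a : Plaq P 0) (X : Plaq P 0 → 𝕄) :
    ∑ p : Plaq P 0, ((linWeight 0 a p : ℝ) : ℂ) • X p = X a := by
  rw [Finset.sum_eq_single a (fun p _ hp => by rw [linWeight_zero_of_ne (Ne.symm hp)]; simp)
    (fun h => absurd (Finset.mem_univ a) h), linWeight_zero_self]
  simp

/-- **THE PROXY UNFOLDS ONE LEVEL**: `Σ_p linWeight (j+1) a′ p • X p = |J|⁻¹ • Σ_J Σ_{t<L} Σ_{s<L} (Σ_p linWeight j (p^J_{s,t}(a′)) p • X p)` — the level-`(j+1)`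
linear proxy is the offset-mean over the coupled index and the tiles of the level-`j` proxies of the tiles (the shape the (S)-engine
✓`…OneStepFullLinearisation.norm_plaqHol_avgFun_sub_one_sub_fullLin_proxy_le` consumes, transports removed). [cite: Balaban1985Averaging, (47)-(48) pp.25-26] -/
theorem sum_linWeight_succ_smul (j : ℕ) (a : Plaq P (j + 1)) (X : Plaq P 0 → 𝕄) :
    ∑ p : Plaq P 0, ((linWeight (j + 1) a p : ℝ) : ℂ) • X p =
      ((Fintype.card ((Fin P.d → Fin P.L) × Equiv.Perm (Fin P.d) × Equiv.Perm (Fin P.d) × Equiv.Perm (Fin P.d) ×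
          Equiv.Perm (Fin P.d)) : ℂ))⁻¹ •
        ∑ J : (Fin P.d → Fin P.L) × Equiv.Perm (Fin P.d) × Equiv.Perm (Fin P.d) × Equiv.Perm (Fin P.d) × Equiv.Perm (Fin P.d),
          ∑ t ∈ Finset.range P.L, ∑ s ∈ Finset.range P.L,
            ∑ p : Plaq P 0, ((linWeight j ⟨shiftN (shiftN (walkEnd (emb a.src) (stairWord J.2.1 (off J.1))) a.ν t) a.μ s, a.μ, a.ν, a.hμν⟩ p
              : ℝ) : ℂ) • X p := by
  simp only [linWeight_succ, Complex.ofReal_mul, Complex.ofReal_inv, Complex.ofReal_natCast, Complex.ofReal_sum, mul_smul, Finset.sum_smul,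
    ← Finset.smul_sum]
  congr 1
  rw [Finset.sum_comm]
  refine Finset.sum_congr rfl fun J _ => ?_
  rw [Finset.sum_comm]
  refine Finset.sum_congr rfl fun t _ => ?_
  rw [Finset.sum_comm]

end Proxy

end Summit.QuantumFields.YangMills.Theorems.UnitScaleGibbsBlockPlaquetteLinWeight

end
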